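import Mathlib.RingTheory.PolynomialAlgebra
import Mathlib.RingTheory.TensorProduct.Quotient
import Mathlib.RingTheory.RingHom.Flat
import Mathlib.RingTheory.Flat.Stability
import Mathlib.RingTheory.AdicCompletion.LocalRing
import Mathlib.RingTheory.AdicCompletion.AsTensorProduct
import Literature.AlgebraicGeometry.Resolution.AdicCompletionRegular
import Summits.ResolutionOfSingularities.ResolutionOfSingularities.Theorems.HilbertSamuelEliminationSigmaMaxModificationsCorridor3WLadderCPFrameLocalChart
import HarnessLib

/-!
# CP frames: completing the base (P2c) [OURS · L1 W4.2 · D18]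

Ladder W4.2 (`Summits/…/LADDER-RESOLUTION.md`), crux chain w42, D18 (near-point persistence of CP frames), object (P2c) of
res-D-pv-050's D18 roadmap (HANDOFF 2026-08-27 11:33Z), cut (FB) of RULING v3.14-17. Pure commutative algebra, 0 definitions.

The vertex-preparation binder `hVP` of `exists_isCPFrame_of_presentation` (…WLadderCPFrameTranslate) is stated over COMPLETE
regular local rings, while the near-point frame produced by the chart computation lives over `R' = R[I_J/u_{j₀}]_𝔮`, which is
regular local but not complete. This file moves a hypersurface-frame presentation `φ : 𝒪 → R[X]/(h)` to the completion
`R̂ = AdicCompletion 𝔪_R R` and checks that every clause survives.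

* `flat_quotientMap_span_map` — `T` flat over `R` ⇒ `R[X]/(h) → T[X]/(h^T)` flat (Mathlib: `Algebra.IsPushout R T R[X] T[X]`,
  `RingHom.Flat.isStableUnderBaseChange`, `Algebra.TensorProduct.quotIdealMapEquivQuotTensor`).
* `isLocalRing_quotient_span_of_coeff_mem` — `S` local, `g` monic of degree `≥ 1` with lower coefficients in `𝔪_S` ⇒ `S[X]/(g)`
  local with `𝔪 = 𝔪_S S[X]/(g) + (x)` (transport of `isLocalRing_adjoinRoot_of_fibre`, …WLadderCPFrameLocalChart, to the
  quotient carrier of `IsCPFrame`).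
* `quotientMap_span_map_local` — along `R → T` local with `𝔪_R T = 𝔪_T`: `ψ : R[X]/(h) → T[X]/(h^T)` is local, `𝔪 ψ = 𝔪`,
  and (if `R → T` is residue-onto) `T[X]/(h^T) = ψ(R[X]/(h)) + 𝔪`.
* `presentation_baseChange` — the four presentation clauses (local, flat, `𝔪 ↦ 𝔪`, residue-onto) of `ψ ∘ φ`.
* `adicCompletion_frame_data`, `adicCompletion_presentation` — the case `T = R̂`: `R̂` regular local of the same dimension
  (tree `isRegularLocalRing_adicCompletion`, `ringKrullDim_adicCompletion`), `𝔪_{R̂}`-adically complete, `u` an r.s.p. of `R̂`,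
  `h^{R̂}` monic of the same degree with the coefficient conditions transported, and the presentation clauses for
  `φ̂ : 𝒪 → R̂[X]/(h^{R̂})` (Mathlib: `AdicCompletion.flat_of_isNoetherian`, `maximalIdeal_eq_map`,
  `residueField_map_bijective`, the `IsAdicComplete` instance).
-/

set_option linter.dupNamespace false

noncomputable section

open Polynomial IsLocalRing
open scoped TensorProduct

universe u

namespace Summit.ResolutionOfSingularities.ResolutionOfSingularities.Theorems.SigmaMaxModificationsCorridor3.Helpers

section Flat

variable {R T : Type u} [CommRing R] [CommRing T] [Algebra R T]

/-- `(h) ⊆ (h^T) ∩ R[X]`: the hypersurface equation maps to its image. -/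
theorem span_le_comap_span_map (h : R[X]) :
    Ideal.span {h} ≤ (Ideal.span {h.map (algebraMap R T)}).comap (mapRingHom (algebraMap R T)) := by
  rw [Ideal.span_singleton_le_iff_mem, Ideal.mem_comap, coe_mapRingHom]
  exact Ideal.subset_span rfl

/-- `(h) · T[X] = (h^T)`. -/
theorem map_span_eq_span_map (h : R[X]) :
    (Ideal.span {h}).map (mapRingHom (algebraMap R T)) = Ideal.span {h.map (algebraMap R T)} := by
  rw [Ideal.map_span, Set.image_singleton, coe_mapRingHom]

/-- **Base change of a hypersurface quotient along a flat algebra is flat**: if `T` is flat over `R` and `h ∈ R[X]`, the induced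
map `R[X]/(h) → T[X]/(h^T)` is flat (`T[X] = T ⊗_R R[X]` is flat over `R[X]`, Mathlib `Algebra.IsPushout R T R[X] T[X]` +
`RingHom.Flat.isStableUnderBaseChange`; then `T[X]/(h)T[X] = T[X] ⊗_{R[X]} R[X]/(h)`, Mathlib
`Algebra.TensorProduct.quotIdealMapEquivQuotTensor`). [folklore] -/
theorem flat_quotientMap_span_map [Module.Flat R T] (h : R[X]) :
    (Ideal.quotientMap (Ideal.span {h.map (algebraMap R T)}) (mapRingHom (algebraMap R T))
      (span_le_comap_span_map h)).Flat := by
  letI : Algebra R[X] T[X] := Polynomial.algebra R T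
  have halg : algebraMap R[X] T[X] = mapRingHom (algebraMap R T) := rfl
  -- `R[X] → T[X]` is flat
  haveI h1 : Module.Flat R[X] T[X] := by
    have hb := RingHom.Flat.isStableUnderBaseChange R T R[X] T[X]
      (RingHom.flat_algebraMap_iff.mpr ‹Module.Flat R T›)
    exact RingHom.flat_algebraMap_iff.mp hb
  -- quotient by `(h)`
  haveI h2 : Module.Flat (R[X] ⧸ Ideal.span {h}) ((R[X] ⧸ Ideal.span {h}) ⊗[R[X]] T[X]) := inferInstance
  haveI h3 : Module.Flat (R[X] ⧸ Ideal.span {h}) (T[X] ⧸ (Ideal.span {h}).map (algebraMap R[X] T[X])) :=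
    Module.Flat.of_linearEquiv
      (Algebra.TensorProduct.quotIdealMapEquivQuotTensor T[X] (Ideal.span {h})).toLinearEquiv
  have heq : (Ideal.span {h}).map (algebraMap R[X] T[X]) = Ideal.span {h.map (algebraMap R T)} := by
    rw [halg, map_span_eq_span_map]
  have hψ : Ideal.quotientMap (Ideal.span {h.map (algebraMap R T)}) (mapRingHom (algebraMap R T))
      (span_le_comap_span_map h) =
      (Ideal.quotEquivOfEq heq).toRingHom.comp
        (algebraMap (R[X] ⧸ Ideal.span {h}) (T[X] ⧸ (Ideal.span {h}).map (algebraMap R[X] T[X]))) := by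
    refine Ideal.Quotient.ringHom_ext (RingHom.ext fun p => ?_)
    simp only [RingHom.comp_apply, Ideal.quotientMap_mk, RingEquiv.toRingHom_eq_coe, RingHom.coe_coe]
    rw [Ideal.Quotient.algebraMap_quotient_map_quotient, Ideal.quotEquivOfEq_mk]
    rfl
  rw [hψ]
  exact RingHom.Flat.comp (RingHom.flat_algebraMap_iff.mpr h3)
    (RingHom.Flat.of_bijective (Ideal.quotEquivOfEq heq).bijective)

end Flat

section Local

variable {R T : Type u} [CommRing R] [CommRing T]

/-- **`S[X]/(g)` is local when the fibre polynomial is `X^m`**: for `S` local and `g` monic of degree `m ≥ 1` with all lower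
coefficients in `𝔪_S`, the quotient `S[X]/(g)` is a local ring with maximal ideal `𝔪_S · S[X]/(g) + (x)` (`x` the class of
`X`). (The case `θ = 0` of `isLocalRing_adjoinRoot_of_fibre`, …WLadderCPFrameLocalChart, transported from `AdjoinRoot g` to the
quotient carrier used by `IsCPFrame`.) [folklore] -/
theorem isLocalRing_quotient_span_of_coeff_mem [IsLocalRing R] {g : R[X]} (hg : g.Monic) (hdeg : 0 < g.natDegree)
    (hco : ∀ i < g.natDegree, g.coeff i ∈ maximalIdeal R) :
    ∃ _ : IsLocalRing (R[X] ⧸ Ideal.span {g}),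
      maximalIdeal (R[X] ⧸ Ideal.span {g}) =
        (maximalIdeal R).map ((Ideal.Quotient.mk (Ideal.span {g})).comp C) ⊔
          Ideal.span {Ideal.Quotient.mk (Ideal.span {g}) X} := by
  have hθ : ∀ i < g.natDegree, (g.comp (X + C 0)).coeff i ∈ maximalIdeal R := by
    intro i hi
    rw [map_zero, add_zero, comp_X]
    exact hco i hi
  obtain ⟨hloc, hmax⟩ := Moving.isLocalRing_adjoinRoot_of_fibre hg hdeg 0 hθ
  refine ⟨hloc, ?_⟩
  rw [map_zero, sub_zero] at hmax
  exact hmax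

variable [Algebra R T]

/-- Coefficients of `h^T` lie in the extended powers: `coeff_i h ∈ 𝔪_R^k ⇒ coeff_i h^T ∈ (𝔪_R T)^k`. -/
theorem coeff_map_mem_pow_of_coeff_mem_pow [IsLocalRing R] [IsLocalRing T]
    (hmT : (maximalIdeal R).map (algebraMap R T) = maximalIdeal T) {h : R[X]} {i k : ℕ}
    (hi : h.coeff i ∈ maximalIdeal R ^ k) : (h.map (algebraMap R T)).coeff i ∈ maximalIdeal T ^ k := by
  rw [coeff_map, ← hmT, ← Ideal.map_pow]
  exact Ideal.mem_map_of_mem _ hi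

/-- **Base change of a hypersurface frame along `R → T` with `𝔪_R T = 𝔪_T`: the local structure.** For `R`, `T` local,
`𝔪_R T = 𝔪_T`, and `h ∈ R[X]` monic of degree `m ≥ 1` with lower coefficients in `𝔪_R`: both `B = R[X]/(h)` and
`B^T = T[X]/(h^T)` are local, the induced map `ψ : B → B^T` is local and carries `𝔪_B` ONTO a generating set of `𝔪_{B^T}`
(`𝔪_B · B^T = 𝔪_{B^T}`), and — if `R → T` is residue-onto — every element of `B^T` is congruent mod `𝔪_{B^T}` to an element
of `ψ(B)`. [folklore] -/
theorem quotientMap_span_map_local [IsLocalRing R] [IsLocalRing T]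
    (hmT : (maximalIdeal R).map (algebraMap R T) = maximalIdeal T) {h : R[X]} (hmo : h.Monic) (hm : 0 < h.natDegree)
    (hco : ∀ i < h.natDegree, h.coeff i ∈ maximalIdeal R) :
    ∃ (_ : IsLocalRing (R[X] ⧸ Ideal.span {h})) (_ : IsLocalRing (T[X] ⧸ Ideal.span {h.map (algebraMap R T)})),
      (maximalIdeal (R[X] ⧸ Ideal.span {h})).map
          (Ideal.quotientMap (Ideal.span {h.map (algebraMap R T)}) (mapRingHom (algebraMap R T))
            (span_le_comap_span_map h)) = maximalIdeal (T[X] ⧸ Ideal.span {h.map (algebraMap R T)}) ∧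
      IsLocalHom (Ideal.quotientMap (Ideal.span {h.map (algebraMap R T)}) (mapRingHom (algebraMap R T))
            (span_le_comap_span_map h)) ∧
      ((Function.Surjective ((residue T).comp (algebraMap R T))) →
        ∀ z : T[X] ⧸ Ideal.span {h.map (algebraMap R T)}, ∃ b : R[X] ⧸ Ideal.span {h},
          z - Ideal.quotientMap (Ideal.span {h.map (algebraMap R T)}) (mapRingHom (algebraMap R T))
            (span_le_comap_span_map h) b ∈ maximalIdeal (T[X] ⧸ Ideal.span {h.map (algebraMap R T)})) := by
  set σ := algebraMap R T with hσ
  set ψ := Ideal.quotientMap (Ideal.span {h.map σ}) (mapRingHom σ) (span_le_comap_span_map h) with hψ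
  have hmo' : (h.map σ).Monic := hmo.map _
  have hdeg' : (h.map σ).natDegree = h.natDegree := hmo.natDegree_map _
  have hco' : ∀ i < (h.map σ).natDegree, (h.map σ).coeff i ∈ maximalIdeal T := by
    intro i hi
    have := coeff_map_mem_pow_of_coeff_mem_pow (k := 1) hmT (h := h) (i := i) (by rw [pow_one]; exact hco i (hdeg' ▸ hi))
    rwa [pow_one] at this
  obtain ⟨hB, hmB⟩ := isLocalRing_quotient_span_of_coeff_mem hmo hm hco
  obtain ⟨hBT, hmBT⟩ := isLocalRing_quotient_span_of_coeff_mem hmo' (hdeg'.symm ▸ hm) hco'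
  -- `ψ` on the generators
  have hψC : ψ.comp ((Ideal.Quotient.mk (Ideal.span {h})).comp C) =
      ((Ideal.Quotient.mk (Ideal.span {h.map σ})).comp C).comp σ := by
    refine RingHom.ext fun r => ?_
    simp only [RingHom.comp_apply, hψ, Ideal.quotientMap_mk, coe_mapRingHom, map_C]
  have hψX : ψ (Ideal.Quotient.mk (Ideal.span {h}) X) = Ideal.Quotient.mk (Ideal.span {h.map σ}) X := by
    rw [hψ, Ideal.quotientMap_mk, coe_mapRingHom, map_X]
  have hmap : (maximalIdeal (R[X] ⧸ Ideal.span {h})).map ψ = maximalIdeal (T[X] ⧸ Ideal.span {h.map σ}) := by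
    rw [hmB, hmBT, Ideal.map_sup, Ideal.map_map, hψC, ← Ideal.map_map, hmT, Ideal.map_span, Set.image_singleton, hψX]
  refine ⟨hB, hBT, hmap, ?_, fun hres z => ?_⟩
  · exact ((local_hom_TFAE ψ).out 0 2).mpr hmap.le
  · obtain ⟨q, rfl⟩ := Ideal.Quotient.mk_surjective z
    obtain ⟨r, hr⟩ := hres (residue T (q.coeff 0))
    refine ⟨Ideal.Quotient.mk _ (C r), ?_⟩
    rw [hψ, Ideal.quotientMap_mk, coe_mapRingHom, map_C, ← map_sub, hmBT]
    -- `q - C (σ r) = (q - C (q₀)) + C (q₀ - σ r)`, the first divisible by `X`, the second in `𝔪_T`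
    have hsplit : q - C (σ r) = (q - C (q.coeff 0)) + C (q.coeff 0 - σ r) := by
      rw [map_sub]; ring
    rw [hsplit, map_add]
    refine Ideal.add_mem _ (Ideal.mem_sup_right ?_) (Ideal.mem_sup_left ?_)
    · obtain ⟨q', hq'⟩ : X ∣ q - C (q.coeff 0) := by
        rw [X_dvd_iff, coeff_sub, coeff_C_zero, sub_self]
      rw [hq', map_mul]
      exact Ideal.mul_mem_right _ _ (Ideal.mem_span_singleton_self _)
    · have hmem : q.coeff 0 - σ r ∈ maximalIdeal T := by
        rw [← residue_eq_zero_iff, map_sub, sub_eq_zero]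
        exact (RingHom.comp_apply _ _ _ ▸ hr).symm
      exact Ideal.mem_map_of_mem _ hmem

end Local

section Presentation

variable {R T : Type u} [CommRing R] [CommRing T] [Algebra R T]

/-- **Base change of a frame presentation along a flat local algebra with `𝔪_R T = 𝔪_T` and the same residue field.**
If `φ : O → B = R[X]/(h)` is local, flat, carries `𝔪_O` onto generators of `𝔪_B` and is residue-onto, and `R → T` is flat
with `𝔪_R T = 𝔪_T` and residue-onto, then the composite `O → B → B^T = T[X]/(h^T)` is again local, flat, `𝔪 ↦ 𝔪`, and
residue-onto (`h` monic of degree `m ≥ 1` with lower coefficients in `𝔪_R`). [folklore] -/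
theorem presentation_baseChange [IsLocalRing R] [IsLocalRing T] [Module.Flat R T]
    (hmT : (maximalIdeal R).map (algebraMap R T) = maximalIdeal T)
    (hres : Function.Surjective ((residue T).comp (algebraMap R T)))
    {h : R[X]} (hmo : h.Monic) (hm : 0 < h.natDegree) (hco : ∀ i < h.natDegree, h.coeff i ∈ maximalIdeal R)
    {O : Type*} [CommRing O] [IsLocalRing O] [IsLocalRing (R[X] ⧸ Ideal.span {h})]
    {φ : O →+* R[X] ⧸ Ideal.span {h}} (hφloc : IsLocalHom φ) (hflat : φ.Flat)
    (hmap : (maximalIdeal O).map φ = maximalIdeal _) (hsurj : Function.Surjective ((residue _).comp φ)) :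
    ∃ _ : IsLocalRing (T[X] ⧸ Ideal.span {h.map (algebraMap R T)}),
      IsLocalHom ((Ideal.quotientMap (Ideal.span {h.map (algebraMap R T)}) (mapRingHom (algebraMap R T))
        (span_le_comap_span_map h)).comp φ) ∧
      ((Ideal.quotientMap (Ideal.span {h.map (algebraMap R T)}) (mapRingHom (algebraMap R T))
        (span_le_comap_span_map h)).comp φ).Flat ∧
      (maximalIdeal O).map ((Ideal.quotientMap (Ideal.span {h.map (algebraMap R T)}) (mapRingHom (algebraMap R T))
        (span_le_comap_span_map h)).comp φ) = maximalIdeal _ ∧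
      Function.Surjective ((residue _).comp ((Ideal.quotientMap (Ideal.span {h.map (algebraMap R T)})
        (mapRingHom (algebraMap R T)) (span_le_comap_span_map h)).comp φ)) := by
  obtain ⟨_, hBT, hmapψ, hψloc, hresψ⟩ := quotientMap_span_map_local hmT hmo hm hco
  set ψ := Ideal.quotientMap (Ideal.span {h.map (algebraMap R T)}) (mapRingHom (algebraMap R T))
    (span_le_comap_span_map h) with hψ
  haveI := hφloc
  haveI := hψloc
  refine ⟨hBT, inferInstance, RingHom.Flat.comp hflat (flat_quotientMap_span_map h), ?_, ?_⟩
  · rw [← Ideal.map_map, hmap, hmapψ]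
  · intro y
    obtain ⟨z, rfl⟩ := residue_surjective y
    obtain ⟨b, hb⟩ := hresψ hres z
    obtain ⟨o, ho⟩ := hsurj (residue _ b)
    refine ⟨o, ?_⟩
    rw [RingHom.comp_apply] at ho
    rw [RingHom.comp_apply, RingHom.comp_apply, ← sub_eq_zero, ← map_sub, residue_eq_zero_iff]
    have h1 : φ o - b ∈ maximalIdeal _ := by
      rw [← residue_eq_zero_iff, map_sub, sub_eq_zero]
      exact ho
    have h2 : ψ (φ o) - ψ b ∈ maximalIdeal _ := by
      rw [← map_sub]
      exact hmapψ.le (Ideal.mem_map_of_mem _ h1)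
    have h3 : ψ (φ o) - z = (ψ (φ o) - ψ b) - (z - ψ b) := by ring
    rw [h3]
    exact Ideal.sub_mem _ h2 hb

end Presentation

section Completion

variable {R : Type u} [CommRing R]

/-- `R → R̂ → κ(R̂)` is onto: the completion has the same residue field (Mathlib
`AdicCompletion.residueField_map_bijective`). -/
theorem residue_comp_algebraMap_adicCompletion_surjective [IsLocalRing R] [IsNoetherianRing R] :
    Function.Surjective ((residue (AdicCompletion (maximalIdeal R) R)).comp
      (algebraMap R (AdicCompletion (maximalIdeal R) R))) := by
  intro y
  obtain ⟨x, hx⟩ := (AdicCompletion.residueField_map_bijective R).2 y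
  obtain ⟨r, rfl⟩ := residue_surjective x
  exact ⟨r, by rw [RingHom.comp_apply, ← ResidueField.map_residue]; exact hx⟩

/-- An r.s.p. of `R` stays an r.s.p. of `R̂`: `(u) R̂ = 𝔪_R R̂ = 𝔪_{R̂}` (Mathlib `AdicCompletion.maximalIdeal_eq_map`). -/
theorem span_range_algebraMap_adicCompletion [IsLocalRing R] [IsNoetherianRing R] {n : ℕ} {u : Fin n → R}
    (hu : Ideal.span (Set.range u) = maximalIdeal R) :
    Ideal.span (Set.range (algebraMap R (AdicCompletion (maximalIdeal R) R) ∘ u)) =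
      maximalIdeal (AdicCompletion (maximalIdeal R) R) := by
  rw [Set.range_comp, ← Ideal.map_span, hu, AdicCompletion.maximalIdeal_eq_map]

/-- **(P2c, data) Completing the base of a hypersurface frame.** For `R` regular local with r.s.p. `u` and `h ∈ R[X]` monic:
`R̂ = AdicCompletion 𝔪_R R` is regular local (tree `isRegularLocalRing_adicCompletion`), `𝔪_{R̂}`-adically complete, of the
same dimension (tree `ringKrullDim_adicCompletion`), `u` is an r.s.p. of `R̂`, `h^{R̂}` is monic of the same degree, and the
coefficient conditions `coeff_i h ∈ 𝔪_R^k` transport to `R̂` (so `δ > 0` / `δ ≥ 1` / the solvable-vertex data persist).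
[cite: Matsumura1987, Thm. 8.14 and §19 (proof of Thm. 19.5)] -/
theorem adicCompletion_frame_data [IsRegularLocalRing R] {n : ℕ} {u : Fin n → R}
    (hu : Ideal.span (Set.range u) = maximalIdeal R) {h : R[X]} (hmo : h.Monic) :
    IsRegularLocalRing (AdicCompletion (maximalIdeal R) R) ∧
      IsAdicComplete (maximalIdeal (AdicCompletion (maximalIdeal R) R)) (AdicCompletion (maximalIdeal R) R) ∧
      ringKrullDim (AdicCompletion (maximalIdeal R) R) = ringKrullDim R ∧
      Ideal.span (Set.range (algebraMap R (AdicCompletion (maximalIdeal R) R) ∘ u)) =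
        maximalIdeal (AdicCompletion (maximalIdeal R) R) ∧
      (h.map (algebraMap R (AdicCompletion (maximalIdeal R) R))).Monic ∧
      (h.map (algebraMap R (AdicCompletion (maximalIdeal R) R))).natDegree = h.natDegree ∧
      (∀ i k : ℕ, h.coeff i ∈ maximalIdeal R ^ k →
        (h.map (algebraMap R (AdicCompletion (maximalIdeal R) R))).coeff i ∈
          maximalIdeal (AdicCompletion (maximalIdeal R) R) ^ k) :=
  ⟨Literature.AlgebraicGeometry.Resolution.isRegularLocalRing_adicCompletion R, inferInstance,
    Literature.AlgebraicGeometry.Resolution.ringKrullDim_adicCompletion R, span_range_algebraMap_adicCompletion hu,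
    hmo.map _, hmo.natDegree_map _,
    fun _ _ hi => coeff_map_mem_pow_of_coeff_mem_pow AdicCompletion.maximalIdeal_eq_map.symm hi⟩

/-- **(P2c, presentation) Completing the base keeps the presentation clauses.** For `R` Noetherian local, `h ∈ R[X]` monic of
degree `m ≥ 1` with lower coefficients in `𝔪_R`, and a presentation `φ : O → R[X]/(h)` that is local, flat, `𝔪_O ↦ 𝔪` and
residue-onto, the composite `φ̂ : O → R[X]/(h) → R̂[X]/(h^{R̂})` is local, flat (`R → R̂` flat: Mathlib
`AdicCompletion.flat_of_isNoetherian`), `𝔪_O ↦ 𝔪`, and residue-onto, and `R̂[X]/(h^{R̂})` is local. Together with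
`adicCompletion_frame_data` this delivers every hypothesis of `exists_isCPFrame_of_presentation` (…WLadderCPFrameTranslate,
binder hVP over COMPLETE regular local rings) from a frame presentation over a non-complete `R` — e.g. `R = R[I_J/u_{j₀}]_𝔮`
at a near point of the blow-up (…Corridor3CPFrameNearShape + …WLadderCPFrameLocalChart). [cite: Matsumura1987, Thm. 8.8,
Thm. 8.14] -/
theorem adicCompletion_presentation [IsLocalRing R] [IsNoetherianRing R]
    {h : R[X]} (hmo : h.Monic) (hm : 0 < h.natDegree) (hco : ∀ i < h.natDegree, h.coeff i ∈ maximalIdeal R)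
    {O : Type*} [CommRing O] [IsLocalRing O] [IsLocalRing (R[X] ⧸ Ideal.span {h})]
    {φ : O →+* R[X] ⧸ Ideal.span {h}} (hφloc : IsLocalHom φ) (hflat : φ.Flat)
    (hmap : (maximalIdeal O).map φ = maximalIdeal _) (hsurj : Function.Surjective ((residue _).comp φ)) :
    ∃ _ : IsLocalRing ((AdicCompletion (maximalIdeal R) R)[X] ⧸
        Ideal.span {h.map (algebraMap R (AdicCompletion (maximalIdeal R) R))}),
      IsLocalHom ((Ideal.quotientMap (Ideal.span {h.map (algebraMap R (AdicCompletion (maximalIdeal R) R))})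
        (mapRingHom (algebraMap R (AdicCompletion (maximalIdeal R) R))) (span_le_comap_span_map h)).comp φ) ∧
      ((Ideal.quotientMap (Ideal.span {h.map (algebraMap R (AdicCompletion (maximalIdeal R) R))})
        (mapRingHom (algebraMap R (AdicCompletion (maximalIdeal R) R))) (span_le_comap_span_map h)).comp φ).Flat ∧
      (maximalIdeal O).map ((Ideal.quotientMap (Ideal.span {h.map (algebraMap R (AdicCompletion (maximalIdeal R) R))})
        (mapRingHom (algebraMap R (AdicCompletion (maximalIdeal R) R))) (span_le_comap_span_map h)).comp φ) =
        maximalIdeal _ ∧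
      Function.Surjective ((residue _).comp ((Ideal.quotientMap
        (Ideal.span {h.map (algebraMap R (AdicCompletion (maximalIdeal R) R))})
        (mapRingHom (algebraMap R (AdicCompletion (maximalIdeal R) R))) (span_le_comap_span_map h)).comp φ)) :=
  presentation_baseChange AdicCompletion.maximalIdeal_eq_map.symm residue_comp_algebraMap_adicCompletion_surjective
    hmo hm hco hφloc hflat hmap hsurj

end Completion

end Summit.ResolutionOfSingularities.ResolutionOfSingularities.Theorems.SigmaMaxModificationsCorridor3.Helpers

end
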